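import Summits.BirchSwinnertonDyer.BirchSwinnertonDyer.Theses.VerticalContact
import HarnessLib

/-!
# BirchSwinnertonDyer / VerticalContact — crux `VerticalSelmerBound` (stmt-BirchSwinnertonDyer-18432),
# line `toric_control`, stub `stub_normalisingWitness`

Registered stub (skeleton `Cruxes/VerticalSelmerBound/Lines/toric_control.lean`): the `j = 0` normalising witness
(`I₀ := L c*`, `e₀ := e`; ultrametric inequality, the `α_c` are `𝔓`-units). No property of `Φ` is used.
-/

set_option linter.dupNamespace false

noncomputable section

namespace Summit.BirchSwinnertonDyer.BirchSwinnertonDyer.Theorems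

open scoped BigOperators
open Literature

/-- Integers of `K` have `𝔓`-adic valuation at most one in any extension `F` of `K`: the image of
`x : 𝓞 K` under `K → F` is the integer `algebraMap (𝓞 K) (𝓞 F) x` of `F`. -/
theorem vsbWit_val_algebraMap_le_one {K F : Type*} [Field K] [Field F] [NumberField F]
    [Algebra K F] (𝔓 : IsDedekindDomain.HeightOneSpectrum (NumberField.RingOfIntegers F))
    (x : NumberField.RingOfIntegers K) :
    𝔓.valuation F (algebraMap K F (x : K)) ≤ 1 :=
  IsDedekindDomain.HeightOneSpectrum.valuation_le_one 𝔓
    (algebraMap (NumberField.RingOfIntegers K) (NumberField.RingOfIntegers F) x)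

/-- An integer `x` of `K` coprime to the rational prime `p` is a `𝔓`-adic unit at every prime `𝔓` of
`F` above `p`: from `u * x + v * p = 1` and `val x < 1`, `val p < 1` the ultrametric inequality would
give `val 1 < 1`. -/
theorem vsbWit_val_algebraMap_eq_one {K F : Type*} [Field K] [Field F] [NumberField F]
    [Algebra K F] (𝔓 : IsDedekindDomain.HeightOneSpectrum (NumberField.RingOfIntegers F))
    {p : ℕ} (hp : (p : NumberField.RingOfIntegers F) ∈ 𝔓.asIdeal)
    {x : NumberField.RingOfIntegers K} (hx : IsCoprime x (p : NumberField.RingOfIntegers K)) :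
    𝔓.valuation F (algebraMap K F (x : K)) = 1 := by
  refine le_antisymm (vsbWit_val_algebraMap_le_one 𝔓 x) (not_lt.mp fun hlt => ?_)
  obtain ⟨u, v, huv⟩ := hx
  have hpF : 𝔓.valuation F (p : F) < 1 := by
    have h : 𝔓.valuation F (algebraMap (NumberField.RingOfIntegers F) F
        (p : NumberField.RingOfIntegers F)) < 1 :=
      (IsDedekindDomain.HeightOneSpectrum.valuation_lt_one_iff_mem (K := F) 𝔓 _).mpr hp
    rwa [map_natCast] at h
  have h1 : 𝔓.valuation F
      (algebraMap K F ((u * x + v * p : NumberField.RingOfIntegers K) : K)) = 1 := by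
    rw [huv, NumberField.RingOfIntegers.coe_eq_algebraMap, map_one, map_one, map_one]
  have h2 : 𝔓.valuation F
      (algebraMap K F ((u * x + v * p : NumberField.RingOfIntegers K) : K)) < 1 := by
    simp only [map_add, map_mul, map_natCast]
    refine Valuation.map_add_lt _ ?_ ?_ <;> rw [map_mul]
    · calc 𝔓.valuation F (algebraMap K F (u : K)) * 𝔓.valuation F (algebraMap K F (x : K))
          ≤ 1 * 𝔓.valuation F (algebraMap K F (x : K)) :=
            mul_le_mul_left (vsbWit_val_algebraMap_le_one 𝔓 u) _
        _ < 1 := by rwa [one_mul]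
    · calc 𝔓.valuation F (algebraMap K F (v : K)) * 𝔓.valuation F (p : F)
          ≤ 1 * 𝔓.valuation F (p : F) := mul_le_mul_left (vsbWit_val_algebraMap_le_one 𝔓 v) _
        _ < 1 := by rwa [one_mul]
  exact absurd h1 h2.ne

/-- Primitivity from a unit determinant: if `e, e'` are `v`-integral vectors of length two with
`v (e 0 * e' 1 - e 1 * e' 0) = 1`, then some coordinate of `e` is a `v`-unit (otherwise both
products have valuation `< 1`, hence so does their difference). -/
theorem vsbWit_exists_val_eq_one {F Γ₀ : Type*} [Field F] [LinearOrderedCommGroupWithZero Γ₀]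
    (v : Valuation F Γ₀) (e e' : Fin 2 → F) (he : ∀ i, v (e i) ≤ 1) (he' : ∀ i, v (e' i) ≤ 1)
    (hdet : v (e 0 * e' 1 - e 1 * e' 0) = 1) : ∃ i, v (e i) = 1 := by
  by_contra hne
  have hlt : ∀ i, v (e i) < 1 := fun i => lt_of_le_of_ne (he i) fun h => hne ⟨i, h⟩
  have hprod : ∀ i j, v (e i * e' j) < 1 := fun i j => by
    rw [map_mul]
    calc v (e i) * v (e' j) ≤ v (e i) * 1 := mul_le_mul_right (he' j) _
      _ < 1 := by rw [mul_one]; exact hlt i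
  exact absurd hdet (Valuation.map_sub_lt v (hprod 0 1) (hprod 1 0)).ne

/-- **The `j = 0` normalising witness** (crux `VerticalSelmerBound`, line `toric_control`).
In the data of the crux, for every depth `N` and every form `Φ`, the twisted Gross period
`P = Σ_c α_c^{-(k-2)/h_K} Φ(L c)(e)` satisfies `val P ^ 2 ≤ val (Φ(L c⋆)(e)) ^ 2` for a class `c⋆`
maximising the valuation of `Φ(L c)(e)`: the `α_c` are `𝔓`-units because `(α_c) = (a₀ c)^{h_K}` is
prime to `p` and `p ∈ 𝔓` (`vsbWit_val_algebraMap_eq_one`), so each term of `P` has the valuation of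
`Φ(L c)(e)` and the ultrametric inequality (`Valuation.map_sum_le`) bounds `val P` by the maximum.
The normalisers are `I₀ := L c⋆`, which lies in `RI` and is `p`-trivial by the hypotheses `HG (L c)`,
`PT (L c)`, and `e₀ := e`, which is `𝔓`-integral by hypothesis and `𝔓`-primitive by the unit
determinant `val (e 0 * e' 1 - e 1 * e' 0) = 1` with `e'` integral (`vsbWit_exists_val_eq_one`).
No property of `Φ` (the hypothesis `hForm`) is used. Source: refuter rattack 05:21Z (corank-0
slice of the crux); elementary. -/
theorem stub_normalisingWitness :
    ∀ (W : WeierstrassCurve ℚ) [W.IsElliptic] [W.IsGloballyMinimal] (p : ℕ) [Fact p.Prime] (K : Type) [Field K] [NumberField K] (Nplus Nminus : ℕ) (a b : ℚ), let B := QuaternionAlgebra ℚ a 0 b; let R := NumberField.RingOfIntegers K; ∀ (O : Subring B) (F : Type) [Field F] [NumberField F] [Algebra K F] (𝔓 : IsDedekindDomain.HeightOneSpectrum (NumberField.RingOfIntegers F)) (ι : B →ₐ[ℚ] Matrix (Fin 2) (Fin 2) F) (ψ : K →ₐ[ℚ] B) (I₁ : Submodule ℤ B) (e e' : Fin 2 →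 F) (a₀ : ClassGroup R → nonZeroDivisors (Ideal R)) (α : ClassGroup R → R), let val := 𝔓.valuation F; let Λ := Submodule ℤ B; let hK := NumberField.classNumber K; let dK := NumberField.discr K; let spl : ℕ → ℕ := fun q => ((Ideal.span {(q : ℤ)}).primesOver R).ncard; let RI : Set Λ := {J | J.FG ∧ (∀ d : B, ∃ n : ℤ, n ≠ 0 ∧ n • d ∈ J) ∧ (∀ x : B, (∀ y ∈ J, y * x ∈ J) ↔ x ∈ O) ∧ ∃ J' : Λ, (∀ x : B, x ∈ J * J' ↔ ∀ y ∈ J, x * y ∈ J) ∧ (∀ x : B, x ∈ J' * J ↔ x ∈ O)}; let PT : Λ → Prop := fun I => ∃ n₀ : ℕ, n₀.Coprime p ∧ (∀ x ∈ O, (n₀ : ℤ) • x ∈ I) ∧ ∀ x ∈ I, (n₀ : ℤ) • x ∈ O; let PR : (Fin 2 → F) → Prop := fun w => (∀ i, val (w i) ≤ 1) ∧ ∃ i, val (w i) = 1; let L : ClassGroup R → Λ := fun c => Submodule.span ℤ ((fun x : R => ψ (x : K)) '' (a₀ c).1) * I₁; let HG : Λ → Prop := fun J => J ∈ RI ∧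 (∀ x : R, ∀ y ∈ J, ψ (x : K) * y ∈ J) ∧ ∀ x : K, (∀ y ∈ J, ψ x * y ∈ J) → ∃ z : R, (z : K) = x; let ρ : Bˣ → MvPolynomial (Fin 2) F → MvPolynomial (Fin 2) F := fun β P => MvPolynomial.aeval (fun j : Fin 2 => ∑ i : Fin 2, MvPolynomial.X (R := F) i * MvPolynomial.C (ι β.1 i j)) P; ((5 ≤ p ∧ W.HasGoodReductionAtPrime p ∧ ¬ (p : ℤ) ∣ W.frobeniusTrace p ∧ W.HasSurjectiveModNGaloisRep p ∧ ¬ p ∣ 6 * hK ∧ Int.gcd dK (W.conductorNorm ℤ * p) = 1) ∧ (Module.finrank ℚ K = 2 ∧ NumberField.IsTotallyComplex K ∧ dK < -4 ∧ spl p = 2) ∧ (W.conductorNorm ℤ = Nplus * Nminus ∧ Nat.Coprime Nplus Nminus ∧ Squarefree Nminus ∧ Odd Nminus.primeFactors.card ∧ (∀ q : ℕ, q.Prime → q ∣ Nplus → spl q = 2) ∧ (∀ q : ℕ, q.Prime → q ∣ Nminus → spl q = 1 ∧ ¬ (p : ℤ) ∣ padicValRat q W.Δ)) ∧ (a < 0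 ∧ b < 0 ∧ (∀ (q : ℕ) [Fact q.Prime], (∀ x : QuaternionAlgebra ℚ_[q] (a : ℚ_[q]) 0 (b : ℚ_[q]), x ≠ 0 → IsUnit x) ↔ q ∣ Nminus) ∧ ∃ O₁ O₂ : Subring B, (∀ S : Subring B, (S = O₁ ∨ S = O₂) → (S.toAddSubgroup.FG ∧ (∀ d : B, ∃ n : ℤ, n ≠ 0 ∧ n • d ∈ S) ∧ ∀ S' : Subring B, S'.toAddSubgroup.FG → S ≤ S' → S' = S)) ∧ O = O₁ ⊓ O₂ ∧ O.toAddSubgroup.relIndex O₁.toAddSubgroup = Nplus) ∧ ((p : NumberField.RingOfIntegers F) ∈ 𝔓.asIdeal ∧ ∀ x ∈ O, ∀ i j, val (ι x i j) ≤ 1) ∧ (HG I₁ ∧ ∀ c, ClassGroup.mk0 (a₀ c) = c ∧ IsCoprime (a₀ c).1 (Ideal.span {(p : R)}) ∧ Ideal.span {α c} = (a₀ c).1 ^ hK ∧ HG (L c) ∧ PT (L c)) ∧ ((∀ t, Matrix.vecMul e (ι (ψ t)) = (algebraMap K F t) • e) ∧ (∀ t, Matrix.vecMul e' (ι (ψ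 t)) = (algebraMap K F (Algebra.trace ℚ K t) - algebraMap K F t) • e') ∧ (∀ i, val (e i) ≤ 1) ∧ (∀ i, val (e' i) ≤ 1) ∧ val (e 0 * e' 1 - e 1 * e' 0) = 1)) → ∀ (N k : ℕ) (lam : ℕ → F) (Φ : Λ → MvPolynomial (Fin 2) F), ((2 < k ∧ 2 * (p - 1) * p ^ N ∣ k - 2 ∧ 2 * hK ∣ k - 2) ∧ (∀ I ∈ RI, (Φ I).IsHomogeneous (k - 2)) ∧ (∀ (β : Bˣ), ∀ I ∈ RI, Φ (I.map (AddMonoidHom.mulLeft β.1).toIntLinearMap) = ρ β (Φ I)) ∧ (∀ q : ℕ, q.Prime → ¬ q ∣ Nplus * Nminus → ∀ I ∈ RI, ∑ᶠ J ∈ {J : Λ | J ≤ I ∧ J.toAddSubgroup.relIndex I.toAddSubgroup = q ^ 2 ∧ ∀ y ∈ J, ∀ x ∈ O, y * x ∈ J}, Φ J = lam q • Φ I) ∧ (∀ q : ℕ, q.Prime → ¬ q ∣ Nplus * Nminus * p → val (lam q - (W.frobeniusTrace q : F)) ≤ val (p : F) ^ (N + 1)) ∧ val (lam p) = 1 ∧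 ∃ I ∈ RI, PT I ∧ Φ I ≠ 0) → ∃ I₀ ∈ RI, PT I₀ ∧ ∃ e₀ : Fin 2 → F, PR e₀ ∧ val (∑ c, (algebraMap K F (α c : K))⁻¹ ^ ((k - 2) / hK) * MvPolynomial.eval e (Φ (L c))) ^ 2 ≤ val (MvPolynomial.eval e₀ (Φ I₀)) ^ 2 := by
  intro W _ _ p _ K _ _ Nplus Nminus a b B R O F _ _ _ 𝔓 ι ψ I₁ e e' a₀ α val Λ hK dK spl RI PT PR L HG ρ
    hData N k lam Φ _
  obtain ⟨-, -, -, -, h4, h5, h6⟩ := hData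
  -- the `α c` are `𝔓`-units
  have hunit : ∀ c, val (algebraMap K F (α c : K)) = 1 := fun c => by
    refine vsbWit_val_algebraMap_eq_one 𝔓 h4.1 ?_
    rw [← Ideal.isCoprime_span_singleton_iff, (h5.2 c).2.2.1]
    exact (h5.2 c).2.1.pow_left
  -- a class maximising the valuation of its term
  obtain ⟨c₀, -, hc₀⟩ := Finset.exists_max_image Finset.univ
    (fun c => val (MvPolynomial.eval e (Φ (L c)))) Finset.univ_nonempty
  refine ⟨L c₀, (h5.2 c₀).2.2.2.1.1, (h5.2 c₀).2.2.2.2, e,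
    ⟨h6.2.2.1, vsbWit_exists_val_eq_one val e e' h6.2.2.1 h6.2.2.2.1 h6.2.2.2.2⟩, ?_⟩
  refine pow_le_pow_left' (Valuation.map_sum_le val fun c _ => ?_) 2
  rw [map_mul, map_pow, map_inv₀, hunit c, inv_one, one_pow, one_mul]
  exact hc₀ c (Finset.mem_univ c)

end Summit.BirchSwinnertonDyer.BirchSwinnertonDyer.Theorems
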